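import Summits.BirchSwinnertonDyer.BirchSwinnertonDyer.Theorems.ThetaPartnerAtTwoSignedControlAtTwoMuRealCardFour
import Summits.BirchSwinnertonDyer.BirchSwinnertonDyer.Theorems.KolyvaginRoadThreePTSelmerComplementAtOfMiddleExact
import HarnessLib

/-!
# Poitou–Tate duality for Selmer structures (Howard 2004 Thm. 2.1.11, BOTH inclusions) AT the modules `μₙ`, `ℤ/n` and
# the order-`4` modules with `2`-group action — every number field, REAL places included

Route `ThetaPartnerAtTwo`, crux K4 `SignedControlAtTwo` (stmt-BirchSwinnertonDyer-20309), line `eulerchar` v10, lead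
`bsd-wall-tp2-p3` g4 (`--supports stmt-BirchSwinnertonDyer-20309`, helper).  File 8 of the real-place packet: the consumable form.
Consumers of the ∀-module named facts `poitouTate_selmerStructure_duality(_real) K` use them through the conjunct
`SelmerComplement` (Howard's two inclusions «annihilator ⊆ image») at ONE module; bsd-stepL koly3b's
`PTAt.selmerComplementAt_canonical_of_middleExact` turns Milne I 4.10(b) middle exactness at that module (all admissible
`S ⊇ ∞`, prime-power level) into exactly that body for THE canonical invariant maps.  Fed with files 2, 3, 5
(the `E[2]`-with-rational-2-torsion instance follows the same way from file 6, `middleExact_canonical_torsionGaloisModule_two_of_fixedPoint`):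

* `selmerComplementAt_canonical_mu_real` — `ρ = mu K n`, `n` a prime power (e.g. `2^k`), EVERY number field;
* `selmerComplementAt_canonical_trivial_real` — the constant module `ℤ/n` (any trivial structure), `n` a prime power;
* `selmerComplementAt_canonical_of_card_eq_four_of_pow` — `p = 2`: every module of order `4` killed by `2` with `2`-group action.

HONEST FRAMING. THEOREMS ONLY; one-line packagings; these are per-MODULE statements, not the ∀-module fact; no item closes;
BSD is not proved by any of this.

References: [Howard2004HeegnerKolyvagin] Thm. 2.1.11; [MilneADT2006] I Thm. 4.10(b), Thm. 2.6, Cor. 2.3.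
-/

noncomputable section

open CategoryTheory Function NumberField IsDedekindDomain
open scoped NumberField ContRepresentation

set_option linter.dupNamespace false
set_option autoImplicit false

namespace Summit.BirchSwinnertonDyer.BirchSwinnertonDyer.Theorems.SignedEC.MuReal

open Field
open Literature.NumberTheory.GaloisRepresentations Literature.NumberTheory.GaloisCohomology
open Literature.NumberTheory.GaloisRepresentations.DiscreteGaloisModule (mu MuCarrier TateDual tateDual
  localTatePairingZMod unramifiedSubgroup SelmerStructure)
open _root_.TopRep _root_.ContRepresentation _root_.ContinuousCohomology
open Summit.BirchSwinnertonDyer.BirchSwinnertonDyer.Theorems.SchneiderFreeAdditiveX3.PoitouTateReduction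
open Summit.BirchSwinnertonDyer.Rank1Residual.X11b.Three.Koly

variable {K : Type} [Field K] [NumberField K]

/-- **Howard's Thm. 2.1.11 AT `μₙ` (`n` a prime power) for THE canonical invariant maps, EVERY number field, real places
included**: `PTAt.selmerComplementAt_canonical_of_middleExact` fed with `middleExact_mu_level_real`.
[cite: Howard2004HeegnerKolyvagin, Thm. 2.1.11 (arXiv:1202.6340 p. 6)] [cite: MilneADT2006, Ch. I, Thm. 4.10(b)] -/
theorem selmerComplementAt_canonical_mu_real (n : ℕ) [NeZero n] (hn : IsPrimePow n) :
    ∀ (S : Finset (Place K)),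
      (∀ v : HeightOneSpectrum (𝓞 K), (Sum.inr v : Place K) ∉ S →
        ((n : ℕ) : 𝓞 K) ∉ v.asIdeal ∧ GaloisRep.IsUnramifiedAt v (mu K n)) →
    ∀ (𝓕 𝓖 : SelmerStructure (mu K n)), 𝓕 ≤ 𝓖 → 𝓕.IsUnramifiedOutside S → 𝓖.IsUnramifiedOutside S →
      (∀ t : Π v : Place K, galoisCohomology ((mu K n).toLocal v) 1, (∀ v ∈ S, t v ∈ 𝓖 v) →
        (∀ y ∈ ((LocalInvariants.canonical K n).dualSelmerStructure (mu K n) 𝓕).selmerGroup,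
          ∑ v ∈ S, localTatePairingZMod (mu K n) n v (LocalInvariants.canonical K n v) (t v)
            (galoisCohomology.localization ((mu K n).tateDual n) v 1 y) = 0) →
        ∃ x ∈ 𝓖.selmerGroup, ∀ v ∈ S, galoisCohomology.localization (mu K n) v 1 x - t v ∈ 𝓕 v) ∧
      (∀ u : Π v : Place K, galoisCohomology (((mu K n).tateDual n).toLocal v) 1,
        (∀ v ∈ S, u v ∈ (LocalInvariants.canonical K n).dualSelmerStructure (mu K n) 𝓕 v) →
        (∀ x ∈ 𝓖.selmerGroup,
          ∑ v ∈ S, localTatePairingZMod (mu K n) n v (LocalInvariants.canonical K n v)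
            (galoisCohomology.localization (mu K n) v 1 x) (u v) = 0) →
        ∃ y ∈ ((LocalInvariants.canonical K n).dualSelmerStructure (mu K n) 𝓕).selmerGroup,
          ∀ v ∈ S, galoisCohomology.localization ((mu K n).tateDual n) v 1 y - u v ∈
            (LocalInvariants.canonical K n).dualSelmerStructure (mu K n) 𝓖 v) := by
  haveI : Finite (MuCarrier K n) := Literature.NumberTheory.GaloisRepresentations.finite_muCarrier K n
  exact PTAt.selmerComplementAt_canonical_of_middleExact n hn (mu K n) mu_nsmul_eq_zero_level
    (fun S hinf hS t horth => middleExact_mu_level_real S hinf hS t horth)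

/-- **Howard's Thm. 2.1.11 AT the constant module `ℤ/n`** (any discrete structure with trivial action; `n` a prime power,
e.g. `2^k`), THE canonical maps, every number field, real places included: from `middleExact_canonical_trivial_level_real`.
[cite: Howard2004HeegnerKolyvagin, Thm. 2.1.11 (arXiv:1202.6340 p. 6)] [cite: MilneADT2006, Ch. I, Thm. 4.10(b)] -/
theorem selmerComplementAt_canonical_trivial_real (n : ℕ) [NeZero n] (hn : IsPrimePow n) [Finite (ZMod n)]
    (ρ : DiscreteGaloisModule K (ZMod n)) (htriv : ∀ (σ : absoluteGaloisGroup K) (m : ZMod n), ρ σ m = m) :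
    ∀ (S : Finset (Place K)),
      (∀ v : HeightOneSpectrum (𝓞 K), (Sum.inr v : Place K) ∉ S →
        ((n : ℕ) : 𝓞 K) ∉ v.asIdeal ∧ GaloisRep.IsUnramifiedAt v ρ) →
    ∀ (𝓕 𝓖 : SelmerStructure ρ), 𝓕 ≤ 𝓖 → 𝓕.IsUnramifiedOutside S → 𝓖.IsUnramifiedOutside S →
      (∀ t : Π v : Place K, galoisCohomology (ρ.toLocal v) 1, (∀ v ∈ S, t v ∈ 𝓖 v) →
        (∀ y ∈ ((LocalInvariants.canonical K n).dualSelmerStructure ρ 𝓕).selmerGroup,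
          ∑ v ∈ S, localTatePairingZMod ρ n v (LocalInvariants.canonical K n v) (t v)
            (galoisCohomology.localization (ρ.tateDual n) v 1 y) = 0) →
        ∃ x ∈ 𝓖.selmerGroup, ∀ v ∈ S, galoisCohomology.localization ρ v 1 x - t v ∈ 𝓕 v) ∧
      (∀ u : Π v : Place K, galoisCohomology ((ρ.tateDual n).toLocal v) 1,
        (∀ v ∈ S, u v ∈ (LocalInvariants.canonical K n).dualSelmerStructure ρ 𝓕 v) →
        (∀ x ∈ 𝓖.selmerGroup,
          ∑ v ∈ S, localTatePairingZMod ρ n v (LocalInvariants.canonical K n v)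
            (galoisCohomology.localization ρ v 1 x) (u v) = 0) →
        ∃ y ∈ ((LocalInvariants.canonical K n).dualSelmerStructure ρ 𝓕).selmerGroup,
          ∀ v ∈ S, galoisCohomology.localization (ρ.tateDual n) v 1 y - u v ∈
            (LocalInvariants.canonical K n).dualSelmerStructure ρ 𝓖 v) :=
  PTAt.selmerComplementAt_canonical_of_middleExact n hn ρ
    (fun m => by rw [nsmul_eq_mul, ZMod.natCast_self, zero_mul])
    (fun S hinf hS t horth => middleExact_canonical_trivial_level_real ρ htriv S hinf (fun v hv => (hS v hv).1) t horth)

/-- **Howard's Thm. 2.1.11 at level `2` AT every module of order `4` killed by `2` with `2`-group Galois action**, THE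
canonical maps, EVERY number field: from `middleExact_canonical_of_card_eq_four_of_pow`.
[cite: Howard2004HeegnerKolyvagin, Thm. 2.1.11 (arXiv:1202.6340 p. 6)] [cite: MilneADT2006, Ch. I, Thm. 4.10(b)] -/
theorem selmerComplementAt_canonical_of_card_eq_four_of_pow [Fact (Nat.Prime 2)]
    {M : Type} [AddCommGroup M] [TopologicalSpace M] [DiscreteTopology M] [Finite M]
    (ρ : DiscreteGaloisModule K M) (h2M : ∀ m : M, 2 • m = 0) (hcard : Nat.card M = 2 ^ 2)
    (hpow : ∀ σ : absoluteGaloisGroup K, ∃ k : ℕ, (ρ σ) ^ (2 ^ k) = 1) :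
    ∀ (S : Finset (Place K)),
      (∀ v : HeightOneSpectrum (𝓞 K), (Sum.inr v : Place K) ∉ S →
        ((2 : ℕ) : 𝓞 K) ∉ v.asIdeal ∧ GaloisRep.IsUnramifiedAt v ρ) →
    ∀ (𝓕 𝓖 : SelmerStructure ρ), 𝓕 ≤ 𝓖 → 𝓕.IsUnramifiedOutside S → 𝓖.IsUnramifiedOutside S →
      (∀ t : Π v : Place K, galoisCohomology (ρ.toLocal v) 1, (∀ v ∈ S, t v ∈ 𝓖 v) →
        (∀ y ∈ ((LocalInvariants.canonical K 2).dualSelmerStructure ρ 𝓕).selmerGroup,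
          ∑ v ∈ S, localTatePairingZMod ρ 2 v (LocalInvariants.canonical K 2 v) (t v)
            (galoisCohomology.localization (ρ.tateDual 2) v 1 y) = 0) →
        ∃ x ∈ 𝓖.selmerGroup, ∀ v ∈ S, galoisCohomology.localization ρ v 1 x - t v ∈ 𝓕 v) ∧
      (∀ u : Π v : Place K, galoisCohomology ((ρ.tateDual 2).toLocal v) 1,
        (∀ v ∈ S, u v ∈ (LocalInvariants.canonical K 2).dualSelmerStructure ρ 𝓕 v) →
        (∀ x ∈ 𝓖.selmerGroup,
          ∑ v ∈ S, localTatePairingZMod ρ 2 v (LocalInvariants.canonical K 2 v)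
            (galoisCohomology.localization ρ v 1 x) (u v) = 0) →
        ∃ y ∈ ((LocalInvariants.canonical K 2).dualSelmerStructure ρ 𝓕).selmerGroup,
          ∀ v ∈ S, galoisCohomology.localization (ρ.tateDual 2) v 1 y - u v ∈
            (LocalInvariants.canonical K 2).dualSelmerStructure ρ 𝓖 v) :=
  PTAt.selmerComplementAt_canonical_of_middleExact 2 (Nat.prime_two.isPrimePow) ρ h2M
    (fun _ hinf hS t horth => middleExact_canonical_of_card_eq_four_of_pow ρ h2M hcard hpow hinf hS t horth)

end Summit.BirchSwinnertonDyer.BirchSwinnertonDyer.Theorems.SignedEC.MuReal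

end
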